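import Summits.QuantumFields.YangMills.Theorems.SwapVirialDeficitLocalTwoSidedStiffness
import HarnessLib

/-!
# Regions with INDIVIDUAL surpluses and a merged core (companion of ✓`SwapVirialDeficitLocalTwoSidedStiffness`)
# (LEAD ym-line-sfw-p2 g98, free hands; cell ym-idea-1; `--supports stmt-QuantumFields-24197`; skeleton ➎ of fcl-p3 g47)

✓`stiffness_of_regions_and_core` lets a CORE (no Laplace law of its own) borrow a uniform surplus `s` from all regions.  Skeleton ➎ for sector `000` has regions
of different kinds — the bulk (stiff with a surplus), the stratum-B tubes (plainly stiff, exponent `α + 1/2`), and the tip∕end core borrowing from the bulk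
alone — so this file gives the variant with a surplus `sur_i` PER REGION: `(κ + sur_i)·Z_{R_i} ≤ b·E_{R_i}` for each region, `κ·Z_N ≤ Σ_i sur_i·Z_{R_i}` for the
core, `κ ≤ b·F` off `N ∪ ⋃R_i` ⟹ `κ·∫e^{−bF} ≤ b·∫F e^{−bF}`; and its two-region specialisation ★ `stiffness_of_bulk_tube_core` (bulk with surplus, one plain
region, one core) — the literal shape of skeleton ➎'s three stubs.

HONEST LABEL: elementary measure theory (a reduction); all region laws OPEN; ⟨24197⟩ ∕ ⟨24194⟩ OPEN; own crux ⟨22884⟩ OPEN (blocked-on ⟨19935⟩); the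
Yang–Mills mass gap is NOT proved; no summit is proved by a line.  THEOREMS ONLY (0 `def`, 0 `sorry`), standard axioms.  References: [folklore]; [cite: Griffiths1964].
-/

set_option autoImplicit false

noncomputable section

open MeasureTheory Set Filter Function
open scoped BigOperators Topology ENNReal

namespace Summit.QuantumFields.YangMills.Theorems.SwapVirialDeficit.SwapRing

section Local

variable {X : Type*} [MeasurableSpace X]

/-- ★★ **REGIONS WITH INDIVIDUAL SURPLUSES AND A MERGED CORE**: `μ` finite, `F ≥ 0` bounded measurable, `b > 0`; pairwise disjoint measurable regions `R_i`,
each stiff with its OWN surplus `sur_i` (`(κ + sur_i)·∫_{R_i}e^{−bF} ≤ b·∫_{R_i}F e^{−bF}`; plainly stiff: `sur_i = 0`); a measurable core `N` disjoint from them with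
`κ·∫_N e^{−bF} ≤ Σ_i sur_i·∫_{R_i}e^{−bF}`; and `κ ≤ b·F` off `N ∪ ⋃R_i`.  Then `κ·∫e^{−bF}dμ ≤ b·∫F e^{−bF}dμ`. [folklore] -/
theorem stiffness_of_regions_and_core' (μ : Measure X) [IsFiniteMeasure μ] {F : X → ℝ} {M : ℝ} (hF : Measurable F) (hbd : ∀ x, |F x| ≤ M)
    (hF0 : ∀ x, 0 ≤ F x) {ι : Type*} (s : Finset ι) (R : ι → Set X) (hR : ∀ i ∈ s, MeasurableSet (R i))
    (hdisj : (s : Set ι).Pairwise (Disjoint on R)) {N : Set X} (hN : MeasurableSet N) (hNdisj : ∀ i ∈ s, Disjoint N (R i))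
    {b κ : ℝ} (sur : ι → ℝ) (hb : 0 < b)
    (hloc : ∀ i ∈ s, (κ + sur i) * ∫ x in R i, Real.exp (-b * F x) ∂μ ≤ b * ∫ x in R i, F x * Real.exp (-b * F x) ∂μ)
    (hcore : κ * ∫ x in N, Real.exp (-b * F x) ∂μ ≤ ∑ i ∈ s, sur i * ∫ x in R i, Real.exp (-b * F x) ∂μ)
    (hfar : ∀ x, x ∉ N → x ∉ (⋃ i ∈ s, R i) → κ ≤ b * F x) :
    κ * ∫ x, Real.exp (-b * F x) ∂μ ≤ b * ∫ x, F x * Real.exp (-b * F x) ∂μ := by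
  classical
  set g : X → ℝ := fun x => (b * F x - κ) * Real.exp (-b * F x) with hg_def
  have hZ := integrable_exp_neg_mul_of_bound μ hF hbd b
  have hE := integrable_mul_exp_neg_mul_of_bound μ hF hbd b
  have hg : Integrable g μ := by
    have h1 : Integrable (fun x => b * (F x * Real.exp (-b * F x)) - κ * Real.exp (-b * F x)) μ := (hE.const_mul b).sub (hZ.const_mul κ)
    refine h1.congr (Eventually.of_forall fun x => ?_)
    simp only [hg_def]; ring
  have hg_int : ∀ (A : Set X), ∫ x in A, g x ∂μ = b * ∫ x in A, F x * Real.exp (-b * F x) ∂μ - κ * ∫ x in A, Real.exp (-b * F x) ∂μ := by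
    intro A
    have e1 : ∫ x in A, g x ∂μ = ∫ x in A, (b * (F x * Real.exp (-b * F x)) - κ * Real.exp (-b * F x)) ∂μ :=
      integral_congr_ae (Eventually.of_forall fun x => by simp only [hg_def]; ring)
    rw [e1, integral_sub (hE.const_mul b).integrableOn (hZ.const_mul κ).integrableOn, integral_const_mul, integral_const_mul]
  suffices h0 : 0 ≤ ∫ x, g x ∂μ by
    have e1 : ∫ x, g x ∂μ = b * ∫ x, F x * Real.exp (-b * F x) ∂μ - κ * ∫ x, Real.exp (-b * F x) ∂μ := by
      have := hg_int univ
      simp only [Measure.restrict_univ] at this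
      exact this
    linarith [e1 ▸ h0]
  set U : Set X := ⋃ i ∈ s, R i with hU_def
  have hU : MeasurableSet U := Finset.measurableSet_biUnion s hR
  have hNU : Disjoint N U := by
    rw [hU_def, Set.disjoint_iUnion₂_right]
    exact fun i hi => hNdisj i hi
  rw [← integral_add_compl (hN.union hU) hg, setIntegral_union hNU hU hg.integrableOn hg.integrableOn]
  have hUsum : ∫ x in U, g x ∂μ = ∑ i ∈ s, ∫ x in R i, g x ∂μ := by
    rw [hU_def, integral_biUnion_finset s hR hdisj (fun i _ => hg.integrableOn)]
  have hregion : ∀ i ∈ s, sur i * ∫ x in R i, Real.exp (-b * F x) ∂μ ≤ ∫ x in R i, g x ∂μ := fun i hi => by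
    rw [hg_int]; linarith [hloc i hi]
  have hUge : ∑ i ∈ s, sur i * ∫ x in R i, Real.exp (-b * F x) ∂μ ≤ ∫ x in U, g x ∂μ := by
    rw [hUsum]
    exact Finset.sum_le_sum hregion
  have hNge : -(κ * ∫ x in N, Real.exp (-b * F x) ∂μ) ≤ ∫ x in N, g x ∂μ := by
    rw [hg_int]
    have h1 : 0 ≤ ∫ x in N, F x * Real.exp (-b * F x) ∂μ :=
      setIntegral_nonneg hN fun x _ => mul_nonneg (hF0 x) (Real.exp_pos _).le
    nlinarith [h1, hb]
  have hrest : 0 ≤ ∫ x in (N ∪ U)ᶜ, g x ∂μ := by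
    refine setIntegral_nonneg (hN.union hU).compl fun x hx => ?_
    have hx' : x ∉ N ∧ x ∉ U := by simpa only [Set.mem_compl_iff, Set.mem_union, not_or] using hx
    have h1 := hfar x hx'.1 (by rw [hU_def] at hx'; exact hx'.2)
    exact mul_nonneg (by linarith) (Real.exp_pos _).le
  linarith [hcore]

/-- ★ **BULK + ONE PLAIN REGION + CORE** (the literal three-stub shape of skeleton ➎, sector `000`): `B` (bulk) stiff with surplus `sur`
(`(κ+sur)·Z_B ≤ b·E_B`), `T` (the stratum-B tubes) plainly stiff (`κ·Z_T ≤ b·E_T`), a core `N` with `κ·Z_N ≤ sur·Z_B`, the three pairwise disjoint and measurable,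
and `κ ≤ b·F` off `N ∪ B ∪ T`.  Then `κ·∫e^{−bF} ≤ b·∫F e^{−bF}`. [folklore] -/
theorem stiffness_of_bulk_tube_core (μ : Measure X) [IsFiniteMeasure μ] {F : X → ℝ} {M : ℝ} (hF : Measurable F) (hbd : ∀ x, |F x| ≤ M)
    (hF0 : ∀ x, 0 ≤ F x) {B T N : Set X} (hB : MeasurableSet B) (hT : MeasurableSet T) (hN : MeasurableSet N)
    (hBT : Disjoint B T) (hNB : Disjoint N B) (hNT : Disjoint N T) {b κ sur : ℝ} (hb : 0 < b)
    (hbulk : (κ + sur) * ∫ x in B, Real.exp (-b * F x) ∂μ ≤ b * ∫ x in B, F x * Real.exp (-b * F x) ∂μ)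
    (htube : κ * ∫ x in T, Real.exp (-b * F x) ∂μ ≤ b * ∫ x in T, F x * Real.exp (-b * F x) ∂μ)
    (hcore : κ * ∫ x in N, Real.exp (-b * F x) ∂μ ≤ sur * ∫ x in B, Real.exp (-b * F x) ∂μ)
    (hfar : ∀ x, x ∉ N → x ∉ B → x ∉ T → κ ≤ b * F x) :
    κ * ∫ x, Real.exp (-b * F x) ∂μ ≤ b * ∫ x, F x * Real.exp (-b * F x) ∂μ := by
  -- index the two regions by `Bool`: `true ↦ B` (surplus `sur`), `false ↦ T` (surplus `0`)
  refine stiffness_of_regions_and_core' μ hF hbd hF0 (Finset.univ : Finset Bool) (fun i => if i then B else T)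
    (fun i _ => by cases i <;> simpa) ?_ hN (fun i _ => by cases i <;> simpa) (fun i => if i then sur else 0) hb ?_ ?_ ?_
  · intro i _ j _ hij
    cases i <;> cases j <;> simp_all [Function.onFun, disjoint_comm]
  · intro i _
    cases i
    · simpa using htube
    · simpa using hbulk
  · simpa using hcore
  · intro x hxN hxU
    refine hfar x hxN (fun hxB => hxU ?_) (fun hxT => hxU ?_)
    · exact Set.mem_iUnion₂.2 ⟨true, Finset.mem_univ _, by simpa using hxB⟩
    · exact Set.mem_iUnion₂.2 ⟨false, Finset.mem_univ _, by simpa using hxT⟩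

end Local

end Summit.QuantumFields.YangMills.Theorems.SwapVirialDeficit.SwapRing

end
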